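import Summits.Ventures.WeilGRH.DoubleReflectionClassesLogTwo
import Summits.Ventures.WeilGRH.CensusDoubleReflectionValues
import HarnessLib

/-!
# GRH arm (rh-explicit, venture WeilGRH): the rung `log 2` for the NAMED census characters of conductor `8 ≤ q ≤ 16`

Cell `rh-explicit`, WEIL TRACK — GRH ARM, seat weil-grh-2 (gen3). The per-class double-reflection theorems of
`DoubleReflectionClassesLogTwo.lean` take hypotheses on `χ(2)`, `χ(3)` (`= 0`, `= 1`, `‖1 − χ(n)‖² = c`, or a box for
`‖1 − χ(n)‖²`); this file DISCHARGES them for the NAMED primitive characters of the census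
`DirichletCharacterCensus20.lean` (`censusRow q n` = Conrey label `q.n`, grh-1's `CensusTwoPrimeRungs.lean`) through
`ConreyRowBridge` (`χ(k) = ζ_ord^{E[k]} = e^{2πi E[k]/ord}`) and the values `2 − 2cos(2πE/ord)` of
`CensusDoubleReflectionValues.lean`, so that every cell below is a tree theorem about a named `L(s, χ)`:
* `8.5` (`weilPositivityOnChar_log_two_census_8_5`)
* `11.5` (`weilPositivityOnChar_log_two_census_11_5`)
* `11.9` (`weilPositivityOnChar_log_two_census_11_9`)
* `12.11` (`weilPositivityOnChar_log_two_census_12_11`)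
* `13.3` (`weilPositivityOnChar_log_two_census_13_3`)
* `13.9` (`weilPositivityOnChar_log_two_census_13_9`)
* `13.6` (`weilPositivityOnChar_log_two_census_13_6`)
* `13.11` (`weilPositivityOnChar_log_two_census_13_11`)
* `15.2` (`weilPositivityOnChar_log_two_census_15_2`)
* `15.8` (`weilPositivityOnChar_log_two_census_15_8`)
* `15.14` (`weilPositivityOnChar_log_two_census_15_14`)
* `16.3` (`weilPositivityOnChar_log_two_census_16_3`)
* `16.11` (`weilPositivityOnChar_log_two_census_16_11`)
* `16.5` (`weilPositivityOnChar_log_two_census_16_5`)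
* `16.13` (`weilPositivityOnChar_log_two_census_16_13`)
No named facts; RH/GRH-free.
-/

noncomputable section

open Complex
open scoped Real ComplexConjugate

namespace Summit.Ventures.WeilGRH

open Literature.NumberTheory.LFunctions

/-- **Cell 8.5 at `log 2`** (`χ(2) = 0`, `‖1 − χ(3)‖² = 4` (`χ(3) = e(1/2)`)). -/
theorem weilPositivityOnChar_log_two_census_8_5 :
    WeilPositivityOnChar ((censusRow 8 5).toChar (census20_check _ (by decide))) (Real.log 2) := by
  have h2 : (censusRow 8 5).toChar (census20_check _ (by decide)) (2 : ZMod _) = 0 := by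
    rw [two_eq_natCast'']; exact censusRow_toChar_natCast_eq_zero _ 2 (by decide)
  have h3 : ‖1 - (censusRow 8 5).toChar (census20_check _ (by decide)) (3 : ZMod _)‖ ^ 2 = 4 := by
    rw [three_eq_natCast'', normSq_one_sub_censusChar _ 3 (by decide), show (censusRow 8 5).e 3 = 1 by decide,
      show (censusRow 8 5).ord = 2 by decide]
    exact twoSubTwoCos_1_2
  exact weilPositivityOnChar_log_two_of_two_dvd_chi_three_neg_one (by decide) _ h2 h3

/-- **Cell 11.5 at `log 2`** (`‖1 − χ(2)‖² ∈ [3.6179, 3.6182]` (`χ(2) = e(2/5)`), `‖1 − χ(3)‖² ∈ [1.3818, 1.3821]` (`χ(3) = e(1/5)`)). -/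
theorem weilPositivityOnChar_log_two_census_11_5 :
    WeilPositivityOnChar ((censusRow 11 5).toChar (census20_check _ (by decide))) (Real.log 2) := by
  have h2 : (3.6179 : ℝ) ≤ ‖1 - (censusRow 11 5).toChar (census20_check _ (by decide)) (2 : ZMod _)‖ ^ 2 ∧
      ‖1 - (censusRow 11 5).toChar (census20_check _ (by decide)) (2 : ZMod _)‖ ^ 2 ≤ 3.6182 := by
    rw [two_eq_natCast'', normSq_one_sub_censusChar _ 2 (by decide), show (censusRow 11 5).e 2 = 2 by decide,
      show (censusRow 11 5).ord = 5 by decide]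
    exact twoSubTwoCos_2_5
  have h3 : (1.3818 : ℝ) ≤ ‖1 - (censusRow 11 5).toChar (census20_check _ (by decide)) (3 : ZMod _)‖ ^ 2 ∧
      ‖1 - (censusRow 11 5).toChar (census20_check _ (by decide)) (3 : ZMod _)‖ ^ 2 ≤ 1.3821 := by
    rw [three_eq_natCast'', normSq_one_sub_censusChar _ 3 (by decide), show (censusRow 11 5).e 3 = 1 by decide,
      show (censusRow 11 5).ord = 5 by decide]
    exact twoSubTwoCos_1_5
  exact weilPositivityOnChar_log_two_class_11_5 (by decide) _ h2.1 h2.2 h3.1 h3.2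

/-- **Cell 11.9 at `log 2`** (`‖1 − χ(2)‖² ∈ [3.6179, 3.6182]` (`χ(2) = e(3/5)`), `‖1 − χ(3)‖² ∈ [1.3818, 1.3821]` (`χ(3) = e(4/5)`)). -/
theorem weilPositivityOnChar_log_two_census_11_9 :
    WeilPositivityOnChar ((censusRow 11 9).toChar (census20_check _ (by decide))) (Real.log 2) := by
  have h2 : (3.6179 : ℝ) ≤ ‖1 - (censusRow 11 9).toChar (census20_check _ (by decide)) (2 : ZMod _)‖ ^ 2 ∧
      ‖1 - (censusRow 11 9).toChar (census20_check _ (by decide)) (2 : ZMod _)‖ ^ 2 ≤ 3.6182 := by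
    rw [two_eq_natCast'', normSq_one_sub_censusChar _ 2 (by decide), show (censusRow 11 9).e 2 = 3 by decide,
      show (censusRow 11 9).ord = 5 by decide]
    exact twoSubTwoCos_3_5
  have h3 : (1.3818 : ℝ) ≤ ‖1 - (censusRow 11 9).toChar (census20_check _ (by decide)) (3 : ZMod _)‖ ^ 2 ∧
      ‖1 - (censusRow 11 9).toChar (census20_check _ (by decide)) (3 : ZMod _)‖ ^ 2 ≤ 1.3821 := by
    rw [three_eq_natCast'', normSq_one_sub_censusChar _ 3 (by decide), show (censusRow 11 9).e 3 = 4 by decide,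
      show (censusRow 11 9).ord = 5 by decide]
    exact twoSubTwoCos_4_5
  exact weilPositivityOnChar_log_two_class_11_5 (by decide) _ h2.1 h2.2 h3.1 h3.2

/-- **Cell 12.11 at `log 2`** (`χ(2) = 0`, `χ(3) = 0`). -/
theorem weilPositivityOnChar_log_two_census_12_11 :
    WeilPositivityOnChar ((censusRow 12 11).toChar (census20_check _ (by decide))) (Real.log 2) := by
  have h2 : (censusRow 12 11).toChar (census20_check _ (by decide)) (2 : ZMod _) = 0 := by
    rw [two_eq_natCast'']; exact censusRow_toChar_natCast_eq_zero _ 2 (by decide)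
  have h3 : (censusRow 12 11).toChar (census20_check _ (by decide)) (3 : ZMod _) = 0 := by
    rw [three_eq_natCast'']; exact censusRow_toChar_natCast_eq_zero _ 3 (by decide)
  exact weilPositivityOnChar_log_two_of_six_dvd (by decide) _ h2 h3

/-- **Cell 13.3 at `log 2`** (`‖1 − χ(2)‖² = 3` (`χ(2) = e(1/3)`), `‖1 − χ(3)‖² = 3` (`χ(3) = e(1/3)`)). -/
theorem weilPositivityOnChar_log_two_census_13_3 :
    WeilPositivityOnChar ((censusRow 13 3).toChar (census20_check _ (by decide))) (Real.log 2) := by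
  have h2 : ‖1 - (censusRow 13 3).toChar (census20_check _ (by decide)) (2 : ZMod _)‖ ^ 2 = 3 := by
    rw [two_eq_natCast'', normSq_one_sub_censusChar _ 2 (by decide), show (censusRow 13 3).e 2 = 1 by decide,
      show (censusRow 13 3).ord = 3 by decide]
    exact twoSubTwoCos_1_3
  have h3 : ‖1 - (censusRow 13 3).toChar (census20_check _ (by decide)) (3 : ZMod _)‖ ^ 2 = 3 := by
    rw [three_eq_natCast'', normSq_one_sub_censusChar _ 3 (by decide), show (censusRow 13 3).e 3 = 1 by decide,
      show (censusRow 13 3).ord = 3 by decide]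
    exact twoSubTwoCos_1_3
  exact weilPositivityOnChar_log_two_class_13_3 (by decide) _ h2 h3

/-- **Cell 13.9 at `log 2`** (`‖1 − χ(2)‖² = 3` (`χ(2) = e(2/3)`), `‖1 − χ(3)‖² = 3` (`χ(3) = e(2/3)`)). -/
theorem weilPositivityOnChar_log_two_census_13_9 :
    WeilPositivityOnChar ((censusRow 13 9).toChar (census20_check _ (by decide))) (Real.log 2) := by
  have h2 : ‖1 - (censusRow 13 9).toChar (census20_check _ (by decide)) (2 : ZMod _)‖ ^ 2 = 3 := by
    rw [two_eq_natCast'', normSq_one_sub_censusChar _ 2 (by decide), show (censusRow 13 9).e 2 = 2 by decide,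
      show (censusRow 13 9).ord = 3 by decide]
    exact twoSubTwoCos_2_3
  have h3 : ‖1 - (censusRow 13 9).toChar (census20_check _ (by decide)) (3 : ZMod _)‖ ^ 2 = 3 := by
    rw [three_eq_natCast'', normSq_one_sub_censusChar _ 3 (by decide), show (censusRow 13 9).e 3 = 2 by decide,
      show (censusRow 13 9).ord = 3 by decide]
    exact twoSubTwoCos_2_3
  exact weilPositivityOnChar_log_two_class_13_3 (by decide) _ h2 h3

/-- **Cell 13.6 at `log 2`** (`‖1 − χ(2)‖² ∈ [3.7319, 3.7322]` (`χ(2) = e(5/12)`), `‖1 − χ(3)‖² = 3` (`χ(3) = e(8/12)`)). -/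
theorem weilPositivityOnChar_log_two_census_13_6 :
    WeilPositivityOnChar ((censusRow 13 6).toChar (census20_check _ (by decide))) (Real.log 2) := by
  have h2 : (3.7319 : ℝ) ≤ ‖1 - (censusRow 13 6).toChar (census20_check _ (by decide)) (2 : ZMod _)‖ ^ 2 ∧
      ‖1 - (censusRow 13 6).toChar (census20_check _ (by decide)) (2 : ZMod _)‖ ^ 2 ≤ 3.7322 := by
    rw [two_eq_natCast'', normSq_one_sub_censusChar _ 2 (by decide), show (censusRow 13 6).e 2 = 5 by decide,
      show (censusRow 13 6).ord = 12 by decide]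
    exact twoSubTwoCos_5_12
  have h3 : ‖1 - (censusRow 13 6).toChar (census20_check _ (by decide)) (3 : ZMod _)‖ ^ 2 = 3 := by
    rw [three_eq_natCast'', normSq_one_sub_censusChar _ 3 (by decide), show (censusRow 13 6).e 3 = 8 by decide,
      show (censusRow 13 6).ord = 12 by decide]
    exact twoSubTwoCos_8_12
  exact weilPositivityOnChar_log_two_class_13_6 (by decide) _ h2.1 h2.2 h3

/-- **Cell 13.11 at `log 2`** (`‖1 − χ(2)‖² ∈ [3.7319, 3.7322]` (`χ(2) = e(7/12)`), `‖1 − χ(3)‖² = 3` (`χ(3) = e(4/12)`)). -/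
theorem weilPositivityOnChar_log_two_census_13_11 :
    WeilPositivityOnChar ((censusRow 13 11).toChar (census20_check _ (by decide))) (Real.log 2) := by
  have h2 : (3.7319 : ℝ) ≤ ‖1 - (censusRow 13 11).toChar (census20_check _ (by decide)) (2 : ZMod _)‖ ^ 2 ∧
      ‖1 - (censusRow 13 11).toChar (census20_check _ (by decide)) (2 : ZMod _)‖ ^ 2 ≤ 3.7322 := by
    rw [two_eq_natCast'', normSq_one_sub_censusChar _ 2 (by decide), show (censusRow 13 11).e 2 = 7 by decide,
      show (censusRow 13 11).ord = 12 by decide]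
    exact twoSubTwoCos_7_12
  have h3 : ‖1 - (censusRow 13 11).toChar (census20_check _ (by decide)) (3 : ZMod _)‖ ^ 2 = 3 := by
    rw [three_eq_natCast'', normSq_one_sub_censusChar _ 3 (by decide), show (censusRow 13 11).e 3 = 4 by decide,
      show (censusRow 13 11).ord = 12 by decide]
    exact twoSubTwoCos_4_12
  exact weilPositivityOnChar_log_two_class_13_6 (by decide) _ h2.1 h2.2 h3

/-- **Cell 15.2 at `log 2`** (`‖1 − χ(2)‖² = 2` (`χ(2) = e(3/4)`), `χ(3) = 0`). -/
theorem weilPositivityOnChar_log_two_census_15_2 :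
    WeilPositivityOnChar ((censusRow 15 2).toChar (census20_check _ (by decide))) (Real.log 2) := by
  have h2 : ‖1 - (censusRow 15 2).toChar (census20_check _ (by decide)) (2 : ZMod _)‖ ^ 2 = 2 := by
    rw [two_eq_natCast'', normSq_one_sub_censusChar _ 2 (by decide), show (censusRow 15 2).e 2 = 3 by decide,
      show (censusRow 15 2).ord = 4 by decide]
    exact twoSubTwoCos_3_4
  have h3 : (censusRow 15 2).toChar (census20_check _ (by decide)) (3 : ZMod _) = 0 := by
    rw [three_eq_natCast'']; exact censusRow_toChar_natCast_eq_zero _ 3 (by decide)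
  exact weilPositivityOnChar_log_two_class_15_2 (by decide) _ h2 h3

/-- **Cell 15.8 at `log 2`** (`‖1 − χ(2)‖² = 2` (`χ(2) = e(1/4)`), `χ(3) = 0`). -/
theorem weilPositivityOnChar_log_two_census_15_8 :
    WeilPositivityOnChar ((censusRow 15 8).toChar (census20_check _ (by decide))) (Real.log 2) := by
  have h2 : ‖1 - (censusRow 15 8).toChar (census20_check _ (by decide)) (2 : ZMod _)‖ ^ 2 = 2 := by
    rw [two_eq_natCast'', normSq_one_sub_censusChar _ 2 (by decide), show (censusRow 15 8).e 2 = 1 by decide,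
      show (censusRow 15 8).ord = 4 by decide]
    exact twoSubTwoCos_1_4
  have h3 : (censusRow 15 8).toChar (census20_check _ (by decide)) (3 : ZMod _) = 0 := by
    rw [three_eq_natCast'']; exact censusRow_toChar_natCast_eq_zero _ 3 (by decide)
  exact weilPositivityOnChar_log_two_class_15_2 (by decide) _ h2 h3

/-- **Cell 15.14 at `log 2`** (`χ(2) = 1`, `χ(3) = 0`). -/
theorem weilPositivityOnChar_log_two_census_15_14 :
    WeilPositivityOnChar ((censusRow 15 14).toChar (census20_check _ (by decide))) (Real.log 2) := by
  have h2 : (censusRow 15 14).toChar (census20_check _ (by decide)) (2 : ZMod _) = 1 := by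
    rw [two_eq_natCast'']; exact censusRow_toChar_natCast_eq_one _ 2 (by decide) (by decide)
  have h3 : (censusRow 15 14).toChar (census20_check _ (by decide)) (3 : ZMod _) = 0 := by
    rw [three_eq_natCast'']; exact censusRow_toChar_natCast_eq_zero _ 3 (by decide)
  exact weilPositivityOnChar_log_two_class_15_14 (by decide) _ h2 h3

/-- **Cell 16.3 at `log 2`** (`χ(2) = 0`, `‖1 − χ(3)‖² = 2` (`χ(3) = e(3/4)`)). -/
theorem weilPositivityOnChar_log_two_census_16_3 :
    WeilPositivityOnChar ((censusRow 16 3).toChar (census20_check _ (by decide))) (Real.log 2) := by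
  have h2 : (censusRow 16 3).toChar (census20_check _ (by decide)) (2 : ZMod _) = 0 := by
    rw [two_eq_natCast'']; exact censusRow_toChar_natCast_eq_zero _ 2 (by decide)
  have h3 : ‖1 - (censusRow 16 3).toChar (census20_check _ (by decide)) (3 : ZMod _)‖ ^ 2 = 2 := by
    rw [three_eq_natCast'', normSq_one_sub_censusChar _ 3 (by decide), show (censusRow 16 3).e 3 = 3 by decide,
      show (censusRow 16 3).ord = 4 by decide]
    exact twoSubTwoCos_3_4
  exact weilPositivityOnChar_log_two_class_16_3 (by decide) _ h2 h3

/-- **Cell 16.11 at `log 2`** (`χ(2) = 0`, `‖1 − χ(3)‖² = 2` (`χ(3) = e(1/4)`)). -/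
theorem weilPositivityOnChar_log_two_census_16_11 :
    WeilPositivityOnChar ((censusRow 16 11).toChar (census20_check _ (by decide))) (Real.log 2) := by
  have h2 : (censusRow 16 11).toChar (census20_check _ (by decide)) (2 : ZMod _) = 0 := by
    rw [two_eq_natCast'']; exact censusRow_toChar_natCast_eq_zero _ 2 (by decide)
  have h3 : ‖1 - (censusRow 16 11).toChar (census20_check _ (by decide)) (3 : ZMod _)‖ ^ 2 = 2 := by
    rw [three_eq_natCast'', normSq_one_sub_censusChar _ 3 (by decide), show (censusRow 16 11).e 3 = 1 by decide,
      show (censusRow 16 11).ord = 4 by decide]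
    exact twoSubTwoCos_1_4
  exact weilPositivityOnChar_log_two_class_16_3 (by decide) _ h2 h3

/-- **Cell 16.5 at `log 2`** (`χ(2) = 0`, `‖1 − χ(3)‖² = 2` (`χ(3) = e(3/4)`)). -/
theorem weilPositivityOnChar_log_two_census_16_5 :
    WeilPositivityOnChar ((censusRow 16 5).toChar (census20_check _ (by decide))) (Real.log 2) := by
  have h2 : (censusRow 16 5).toChar (census20_check _ (by decide)) (2 : ZMod _) = 0 := by
    rw [two_eq_natCast'']; exact censusRow_toChar_natCast_eq_zero _ 2 (by decide)
  have h3 : ‖1 - (censusRow 16 5).toChar (census20_check _ (by decide)) (3 : ZMod _)‖ ^ 2 = 2 := by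
    rw [three_eq_natCast'', normSq_one_sub_censusChar _ 3 (by decide), show (censusRow 16 5).e 3 = 3 by decide,
      show (censusRow 16 5).ord = 4 by decide]
    exact twoSubTwoCos_3_4
  exact weilPositivityOnChar_log_two_class_16_3 (by decide) _ h2 h3

/-- **Cell 16.13 at `log 2`** (`χ(2) = 0`, `‖1 − χ(3)‖² = 2` (`χ(3) = e(1/4)`)). -/
theorem weilPositivityOnChar_log_two_census_16_13 :
    WeilPositivityOnChar ((censusRow 16 13).toChar (census20_check _ (by decide))) (Real.log 2) := by
  have h2 : (censusRow 16 13).toChar (census20_check _ (by decide)) (2 : ZMod _) = 0 := by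
    rw [two_eq_natCast'']; exact censusRow_toChar_natCast_eq_zero _ 2 (by decide)
  have h3 : ‖1 - (censusRow 16 13).toChar (census20_check _ (by decide)) (3 : ZMod _)‖ ^ 2 = 2 := by
    rw [three_eq_natCast'', normSq_one_sub_censusChar _ 3 (by decide), show (censusRow 16 13).e 3 = 1 by decide,
      show (censusRow 16 13).ord = 4 by decide]
    exact twoSubTwoCos_1_4
  exact weilPositivityOnChar_log_two_class_16_3 (by decide) _ h2 h3

end Summit.Ventures.WeilGRH
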